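import Literature.Computability.AlgebraicComplexity.DeterminantalComplexity
import Literature.Computability.AlgebraicComplexity.StandardFamiliesProofs
import Literature.Computability.AlgebraicComplexity.RankOneDeterminantalExpressionsProofs

/-!
# `UlrichPadded.OrbitCorankTwo` (stmt-ValiantsHypothesis-15032): constant gauges cannot change the padding order

Negative knowledge for the crux (standing disprover, cycle 1, 2026-08-16), Literature-only part.
The crux asks for a POLYNOMIAL gauge `P, Q ∈ GL_m(ℂ[x])` moving an affine representation `A` of `per_n`
to an affine one all of whose submaximal minors of the LINEAR PART lie in `(per_n)` (`j ≥ 1`).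

* `adjugate_linPart_mem_of_constGauge`: for CONSTANT invertible `P, Q ∈ GL_m(ℂ)` the property
  'every submaximal minor of the linear part lies in the ideal `I`' passes from `P·A·Q` back to `A`
  (`adj L = (det P·det Q)⁻¹ · Q · adj(P L Q) · P`, `linPart_constGauge`); so `j ≥ 1` versus `j = 0` is an
  invariant of the constant-gauge orbit;
* `not_orbitCorankTwo_constGauge_of_tight`: consequently ONE tight affine representation (some
  submaximal minor of its linear part outside `(per_n)`, `n ≥ 3`) refutes the natural strengthening of
  the crux in which `P, Q` are constant.  Such a representation exists — the twisted Grenet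
  `(1+V)·G₇·(1+U)` of `Summit.ValiantsHypothesis.Theorems.UlrichPaddedNoTightInfinity_refuted`
  (stmt-ValiantsHypothesis-5668) — and the unconditional corollary `not_orbitCorankTwo_constGauge` is
  filed separately (it must import the route file); this file stays independent of the route file.

So the x-dependent part of the gauge is load-bearing in the crux.  Inline statements, no new facts.
-/

noncomputable section

namespace Summit.ValiantsHypothesis.Theorems.OrbitCorankTwoNegative

open MvPolynomial Matrix
open Literature.Computability.AlgebraicComplexity

/-- Taking the linear part commutes with a constant two-sided gauge. [folklore] -/
theorem linPart_constGauge {σ : Type*} {m : Type*} [Fintype m] [DecidableEq m]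
    (P Q : Matrix m m ℂ) (A : Matrix m m (MvPolynomial σ ℂ)) :
    (Matrix.of fun a b => homogeneousComponent 1 ((P.map C * A * Q.map C : Matrix m m (MvPolynomial σ ℂ)) a b)) =
      P.map C * (Matrix.of fun a b => homogeneousComponent 1 (A a b)) * Q.map C := by
  have hcomp : ∀ (p q : ℂ) (φ : MvPolynomial σ ℂ),
      homogeneousComponent 1 (C p * φ * C q) = C p * homogeneousComponent 1 φ * C q := by
    intro p q φ
    rw [mul_comm _ (C q), ← mul_assoc, ← C_mul, homogeneousComponent_C_mul, C_mul]
    ring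
  ext a b
  simp only [Matrix.mul_apply, Matrix.map_apply, Matrix.of_apply, map_sum, Finset.sum_mul, hcomp]

/-- Entries of `X * N * Y` lie in any ideal containing the entries of `N`. [folklore] -/
theorem mul_mul_apply_mem {R : Type*} [CommRing R] {m : Type*} [Fintype m]
    (X N Y : Matrix m m R) (I : Ideal R) (hN : ∀ k l, N k l ∈ I) (a b : m) : (X * N * Y) a b ∈ I := by
  simp only [Matrix.mul_apply, Finset.sum_mul]
  exact I.sum_mem fun l _ => I.sum_mem fun k _ => I.mul_mem_right _ (I.mul_mem_left _ (hN k l))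

/-- The ideal membership of the submaximal minors of the linear part is invariant under CONSTANT
invertible gauges `A ↦ P·A·Q`, `P, Q ∈ GL_m(ℂ)`: `adj L = (det P · det Q)⁻¹ · Q · adj (P L Q) · P`. [folklore] -/
theorem adjugate_linPart_mem_of_constGauge {σ : Type*} {m : Type*} [Fintype m] [DecidableEq m]
    (P Q : Matrix m m ℂ) (hP : IsUnit P) (hQ : IsUnit Q) (A : Matrix m m (MvPolynomial σ ℂ))
    (I : Ideal (MvPolynomial σ ℂ))
    (h : ∀ i j, (Matrix.of fun a b =>
      homogeneousComponent 1 ((P.map C * A * Q.map C : Matrix m m (MvPolynomial σ ℂ)) a b)).adjugate i j ∈ I)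
    (i j : m) : (Matrix.of fun a b => homogeneousComponent 1 (A a b)).adjugate i j ∈ I := by
  set L : Matrix m m (MvPolynomial σ ℂ) := Matrix.of fun a b => homogeneousComponent 1 (A a b) with hL
  rw [linPart_constGauge] at h
  have hdP : (P.map C : Matrix m m (MvPolynomial σ ℂ)).det = C P.det := by
    rw [← RingHom.mapMatrix_apply, ← RingHom.map_det]
  have hdQ : (Q.map C : Matrix m m (MvPolynomial σ ℂ)).det = C Q.det := by
    rw [← RingHom.mapMatrix_apply, ← RingHom.map_det]
  have hPd : P.det ≠ 0 := ((Matrix.isUnit_iff_isUnit_det P).1 hP).ne_zero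
  have hQd : Q.det ≠ 0 := ((Matrix.isUnit_iff_isUnit_det Q).1 hQ).ne_zero
  -- `Q' * adj (P' L Q') * P' = (det Q' * det P') • adj L`
  have key : Q.map C * (P.map C * L * Q.map C).adjugate * P.map C =
      (C (Q.det * P.det) : MvPolynomial σ ℂ) • L.adjugate := by
    rw [Matrix.adjugate_mul_distrib, Matrix.adjugate_mul_distrib]
    calc Q.map C * ((Q.map C).adjugate * (L.adjugate * (P.map C).adjugate)) * P.map C
        = (Q.map C * (Q.map C).adjugate) * L.adjugate * ((P.map C).adjugate * P.map C) := by
          simp only [Matrix.mul_assoc]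
      _ = (C (Q.det * P.det) : MvPolynomial σ ℂ) • L.adjugate := by
          rw [Matrix.mul_adjugate, Matrix.adjugate_mul, hdP, hdQ, map_mul]
          simp [smul_smul, mul_comm]
  have hmem : ((C (Q.det * P.det) : MvPolynomial σ ℂ) • L.adjugate) i j ∈ I := by
    rw [← key]
    exact mul_mul_apply_mem _ _ _ I h i j
  have hunit : IsUnit (C (Q.det * P.det) : MvPolynomial σ ℂ) :=
    (IsUnit.mk0 _ (mul_ne_zero hQd hPd)).map C
  rw [Matrix.smul_apply, smul_eq_mul] at hmem
  exact (I.unit_mul_mem_iff_mem hunit).1 hmem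

/-- **One tight representation kills the constant-gauge strengthening of `OrbitCorankTwo`.**  If some
affine representation `A` of `per_n` (`n ≥ 3`) has a submaximal minor of its linear part outside
`(per_n)`, then it is false that every affine representation has a CONSTANT-gauge form `P·A·Q`,
`P, Q ∈ GL_m(ℂ)`, with all such minors in `(per_n)` (by `adjugate_linPart_mem_of_constGauge` the
property would pull back to `A`).  The hypothesis is witnessed by the twisted Grenet matrix of
`UlrichPaddedNoTightInfinity_refuted`. [folklore] -/
theorem not_orbitCorankTwo_constGauge_of_tight
    (htight : ∃ n : ℕ, 3 ≤ n ∧ ∃ (m : ℕ) (A : Matrix (Fin m) (Fin m) (MvPolynomial (Fin n × Fin n) ℂ)),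
      IsAffineDetRepr (perPoly (Fin n) ℂ) A ∧
      ∃ i j, (Matrix.of fun a b => homogeneousComponent 1 (A a b)).adjugate i j ∉
        Ideal.span {perPoly (Fin n) ℂ}) :
    ¬ ∀ n : ℕ, 3 ≤ n → ∀ (m : ℕ) (A : Matrix (Fin m) (Fin m) (MvPolynomial (Fin n × Fin n) ℂ)),
      IsAffineDetRepr (perPoly (Fin n) ℂ) A →
      ∃ P Q : Matrix (Fin m) (Fin m) ℂ, IsUnit P ∧ IsUnit Q ∧
        IsAffineDetRepr (perPoly (Fin n) ℂ) (P.map C * A * Q.map C) ∧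
        ∀ i j, (Matrix.of fun a b => homogeneousComponent 1
          ((P.map C * A * Q.map C : Matrix (Fin m) (Fin m) (MvPolynomial (Fin n × Fin n) ℂ)) a b)).adjugate i j ∈
          Ideal.span {perPoly (Fin n) ℂ} := by
  intro h
  obtain ⟨n, hn, m, A, hA, i, j, hij⟩ := htight
  obtain ⟨P, Q, hP, hQ, -, hmem⟩ := h n hn m A hA
  exact hij (adjugate_linPart_mem_of_constGauge P Q hP hQ A _ hmem i j)

end Summit.ValiantsHypothesis.Theorems.OrbitCorankTwoNegative
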